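import Summits.Ventures.QEC.CircuitDistance.ETowerKX
import Summits.Ventures.QEC.CircuitDistance.ETowerBase
import HarnessLib

/-!
# E-fold tower ([[144,12,12]], W = 9, node K) — sector X, slices 2–2 of `T3X`

STEP 2 of R152 (2) (CARD-7, idea-1 g3/g4; generic port + STEP2-ASSEMBLY-SPEC type-1 g2). `T3X` = the canonical (orbit-minimal) representatives of the
non-zero `V₃`-kernel base words of weight `≤ 9` of the extended `E(3,3)` table `TE3` (sector X, record slot order), as ASCENDING numerals, cut into
consecutive slices `SX_i` (`T3X = SX_0 ++ SX_1 ++ …`, module `ETowerT3X`). Per slice: the UNIT fact (§B8 (ii)) — the nested guarded tower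
`nodeA` (levels A→B→C→`ktop`) passes on `bitsOf 45 0 u` for every `u` — and the BASE-SLICE fact (§B9) — `sliceCheck` (below `2^45`, kernel word of
`tab TE3 15`, weight in `[1,9]`, orbit-minimal) and the per-weight orbit-size sums `osums`. All `decide +kernel`; predicted kernel seconds = idea-1's
`enest` K-node model. No `native_decide`. Emitted by qec-cdx-eng-1 g2 (`emit_step2.py`). Nothing here asserts a value of `d_circ`.
-/

set_option maxRecDepth 100000

namespace Summit.Ventures.QEC.CircuitDistance.ETower.SecX

open Summit.Ventures.QEC.Census Summit.Ventures.QEC.Census.Fold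

/-- slice 2 of `T3X`: 76 canonical base words (weights [4, 5, 6, 7, 8, 9]; predicted 63.4 s on node K; s ≥ 1-rich). -/
def SX_2 : List ℕ := [262202, 262594, 262653, 277716, 277779, 277804, 284302, 284337, 284489, 289376, 289688, 299522, 299581, 299973, 306964, 312457, 312502, 312654, 312689, 325720, 326048, 334035, 334060, 334100, 334123, 336898, 336957, 337349, 347736, 348064, 357001, 363220, 363283, 363308, 374277, 384096, 385166, 385201, 385353, 401033, 402008, 402023, 402336, 411650, 411709, 412101, 423188, 429198, 429233, 429385, 438368, 438680, 449029, 460384, 460696, 479444, 479507, 479532, 486405, 496728, 497056, 501897, 508692, 786438, 786489, 786881, 802064, 823809, 836746, 858320, 858408, 861185, 887568, 926308, 935937, 1003792]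

set_option maxHeartbeats 400000000 in
/-- UNIT FACT (§B8 (ii)): every word of slice 2 passes the tower `nodeA`. -/
theorem unitsX_2 : (SX_2.map (bitsOf 45 0)).all nodeA = true := by decide +kernel

set_option maxHeartbeats 400000000 in
/-- BASE-SLICE FACT (§B9): slice 2 passes `sliceCheck` over `tab TE3 15` and has per-weight orbit-size sums `[0, 0, 0, 9, 45, 45, 63, 63, 459]`. -/
theorem baseX_2 : sliceCheck (tab TE3 15) 3 3 5 9 SX_2 = true ∧ osums 3 3 5 9 SX_2 = [0, 0, 0, 9, 45, 45, 63, 63, 459] := by decide +kernel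

end Summit.Ventures.QEC.CircuitDistance.ETower.SecX
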